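import Summits.QuantumFields.BalabanUV.T4Continuum.Support.NE7ApeCurvedRepRoadBLifted
import HarnessLib

/-!
# NE7ApeCurvedRepRoadBFinal — ROAD (B), THE ANALYTIC RESIDUE ISOLATED: the curved (APE) with a datum at a tangent-critical background ⇐ E′'s REGIME + **α₁ FOR E′'s
# LANDAU REPRESENTATIVE** (`‖Ad(W(y+e_κ,τ))Z(y+e_τ,κ) − Z(y,κ)‖ ≤ α₁^Z` for the Landau `Z` of radius `α_E` — ONE field, no structure quantifier) + (L2) — F112 with the
# gradient member of the same-top structured fields `Z′ = Z − gaugeDir_W σ̃ + N` reduced KINEMATICALLY to that of `Z`: `α₁(Z′) ≤ α₁^Z + 8θ_u + 8(6θ_u)(α_E + 4θ_u)`; file 44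

Cell `pub-balaban`, rung (B)+1 sub-cell t4, lineage `b2b-balaban-t4-ne7-p1` (CRUX PROVER NE7 #1 = OWNER of row NE7), generation 78; memo
`t4/b2b-balaban-t4-ne7-p1-g78/BUMP-CLASS-FLAT.md` §7 PS.  File F113 (over F112 `NE7ApeCurvedRepRoadBLifted.smallField_of_tanCritical_roadB_lifted`,
`AveragingDeficitTransport.norm_Ad_of_unitary`).
WHY.  F112 left two analytic letters, α₁ (`hGrad`, quantified over the structured same-top fields) and (L2).  The gauge part and the second-order part of `Z′` contribute to
the gradient member only through their sup norms (`W` unitary: `‖Ad(W)X‖ = ‖X‖`; `‖gaugeDir_W σ̃‖ ≤ 4θ_u`, `‖N‖ ≤ 4(6θ_u)(α_E+4θ_u)`), so α₁ is needed for E′'s Landau `Z` ALONE —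
an elliptic gradient estimate for the Landau representative (row NE3's E′ exports `‖Z‖_∞` and `‖covDiv_W Z‖_∞`, not this).  THIS FILE performs the reduction, so that road (B)
reads: (APE) with a datum ⇐ E′'s regime + quadratic-remainder regime + α₁^Z + (L2).
WHAT ([folklore]; 0 def, 0 sorry).  `norm_grad_structured_le` (the three-term split) and **`smallField_of_tanCritical_roadB_final`** — F78's conclusion at radius `α₀` with
`α₁ = α₁^Z + 8θ_u + 8(6θ_u)(α_E + 4θ_u)`, `c_N = 4m`, `ν = 24·#Plane·m`.
HONEST FRAMING (page 1): composition + unitary invariance of the norm; α₁^Z and (L2) are HYPOTHESES; nothing of Bałaban's asserted; (APE) on curved data NOT proved; NOT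
ONE-STEP, NOT NE7; spine 0∕9; finite T⁴ rung (B)+1 — NOT infinite volume, NOT mass gap, NOT `BetaPertH`, NOT Clay.  Continuum YM on T⁴ ⇐ BetaPertH ∧ nine spine estimates
(0/9 proved); BetaPertH ⇐ (D1) ∧ (D4) ∧ CAP+tail; G-an2-4 gates asym, D1 and NE2/3/4.
-/

set_option autoImplicit false

open scoped BigOperators Matrix Matrix.Norms.L2Operator
open NormedSpace Finset

namespace Summit.QuantumFields.BalabanUV.T4Continuum.NE7ApeCurvedRepRoadBFinal

open Literature.MathematicalPhysics.QuantumFieldTheory.Balaban1983to89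
open B7Prop1Explicit B7Prop2Explicit MatrixLog UnitaryModel
open T4AveragingDeficitWall (Ad IsUnitaryCfg IsSkewDir SmallField vary curlAt dirL1)
open T4AveragingDeficitWallBoundary (IsPeriodicCfg periodBox)
open AveragingDeficitPeriodicCounting (IsPeriodicDir)
open AveragingDeficitTwoLevelPrep (twoLevelSmall)
open AveragingDeficitMultiLevelPrep (cavgIter LevelSmall)
open MinimalActionLevels (perWin)
open BlockAverageVaryHolo (nbRad)
open BlockAveragePushDirGauge (gaugeDir)
open NE3HessForm (hess dAction)
open NE3TangentCovariantTower (dirIter)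
open NE3EnergyShapes (IsUnitarySite IsPeriodicSite)
open NE3CovariantWeitzenbock (covDiv)
open NE3RightInverseSupLetters (frameC)
open NE3QbarIterCovLiftPrep (cruxC)
open NE3RightInverseSolveLetters (thetaLoc)
open NE3HatInvCurlLetters (curl1C)
open NE3.PairLandauB8 (IsLandauB8)
open BlockAverageVaryDisc (rho0)
open NE3LinearisedAverageSup (curvSum)
open NE3RightInverseSupLetters (supC)
open NE3RightInverseSolveLetters (cruxC_nonneg)
open AveragingDeficitTransport (norm_Ad_of_unitary)
open NE7ApeCurvedRepRoadBLifted (smallField_of_tanCritical_roadB_lifted)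

noncomputable section

variable {d : ℕ} {n : Type*} [Fintype n] [DecidableEq n]

/-- THE THREE-TERM SPLIT of the gradient member of `Z′ = Z − G + N` against unitary `W`:
`‖Ad(V)Z′₁ − Z′₀‖ ≤ ‖Ad(V)Z₁ − Z₀‖ + (‖G₁‖ + ‖G₀‖) + (‖N₁‖ + ‖N₀‖)`, `N = Z′ − (Z − G)`. [folklore] -/
theorem norm_grad_structured_le {V : (Matrix n n ℂ)ˣ} (hV : V ∈ unitaryUnits (Matrix n n ℂ)) (Z1 Z0 G1 G0 Z'1 Z'0 : Matrix n n ℂ) :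
    ‖Ad V Z'1 - Z'0‖ ≤ ‖Ad V Z1 - Z0‖ + (‖G1‖ + ‖G0‖) + (‖Z'1 - (Z1 - G1)‖ + ‖Z'0 - (Z0 - G0)‖) := by
  have key : Ad V Z'1 - Z'0 = (Ad V Z1 - Z0) - (Ad V G1 - G0) + (Ad V (Z'1 - (Z1 - G1)) - (Z'0 - (Z0 - G0))) := by
    unfold Ad; noncomm_ring
  rw [key]
  have h1 : ‖Ad V G1 - G0‖ ≤ ‖G1‖ + ‖G0‖ := (norm_sub_le _ _).trans (by rw [norm_Ad_of_unitary hV])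
  have h2 : ‖Ad V (Z'1 - (Z1 - G1)) - (Z'0 - (Z0 - G0))‖ ≤ ‖Z'1 - (Z1 - G1)‖ + ‖Z'0 - (Z0 - G0)‖ :=
    (norm_sub_le _ _).trans (by rw [norm_Ad_of_unitary hV])
  calc ‖(Ad V Z1 - Z0) - (Ad V G1 - G0) + (Ad V (Z'1 - (Z1 - G1)) - (Z'0 - (Z0 - G0)))‖
      ≤ ‖(Ad V Z1 - Z0) - (Ad V G1 - G0)‖ + ‖Ad V (Z'1 - (Z1 - G1)) - (Z'0 - (Z0 - G0))‖ := norm_add_le _ _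
    _ ≤ (‖Ad V Z1 - Z0‖ + ‖Ad V G1 - G0‖) + ‖Ad V (Z'1 - (Z1 - G1)) - (Z'0 - (Z0 - G0))‖ := by
        have := norm_sub_le (Ad V Z1 - Z0) (Ad V G1 - G0); linarith
    _ ≤ _ := by linarith

/-- **ROAD (B), THE ANALYTIC RESIDUE ISOLATED** (statement in the module docstring). [folklore] -/
theorem smallField_of_tanCritical_roadB_final [Nonempty n] (hd : 2 ≤ d) {L N : ℕ} [NeZero N] (hL : 2 ≤ L) (j : ℕ)
    -- the background
    {W : Site d → Fin d → (Matrix n n ℂ)ˣ} {x : ℝ} (hWu : IsUnitaryCfg W) (hWP : IsPeriodicCfg W ((N * L ^ (j + 1) : ℕ) : ℤ))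
    (hx : 0 ≤ x) (hs : LevelSmall d L j x) (hWx : SmallField W x)
    -- the sup radius of the representative and the regime at `x′ = x + 4(e^{α₀} − 1)`
    {α₀ : ℝ} (hα0 : 0 ≤ α₀) (hs' : LevelSmall d L j (x + 4 * (Real.exp α₀ - 1)))
    (hθ : cruxC d L * (((L : ℝ) ^ (j + 1)) ^ 2 * (x + 4 * (Real.exp α₀ - 1))) < 1)
    (hθl : thetaLoc d L * (((L : ℝ) ^ (j + 1)) ^ 2 * (x + 4 * (Real.exp α₀ - 1))) < 1)
    (hε : ((L : ℝ) ^ (j + 1)) ^ 2 * (x + 4 * (Real.exp α₀ - 1)) ≤ 1)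
    -- the field: of the class, tangent-critical, over `W`'s datum
    {U : Site d → Fin d → (Matrix n n ℂ)ˣ} (hUu : IsUnitaryCfg U) (hUP : IsPeriodicCfg U ((N * L ^ (j + 1) : ℕ) : ℤ))
    {xU : ℝ} (hxU : 0 ≤ xU) (hsU : LevelSmall d L j xU) (hUxU : SmallField U xU)
    (hcritU : ∀ Y : Site d → Fin d → Matrix n n ℂ, IsSkewDir Y → IsPeriodicDir Y ((N * L ^ (j + 1) : ℕ) : ℤ) →
      dirIter L (j + 1) U Y = 0 → dAction U Y (perWin d (N * L ^ (j + 1))) = 0)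
    (hTopUW : cavgIter L (j + 1) U = cavgIter L (j + 1) W)
    -- row NE3's class data of `W` and E′'s initial gauge ∕ regime (as in `exists_landauRep_W`), the constant `c_RE` named; road (B)'s two extra regime lines
    {x₁ : ℝ} (hx10 : 0 ≤ x₁)
    (hgrad : ∀ (p : Site d) (μ κ : Fin d), κ ≠ μ →
      ‖Ad (W p μ) ((hol W (p + e μ) (plaqWord κ μ) : (Matrix n n ℂ)ˣ) : Matrix n n ℂ) - ((hol W p (plaqWord κ μ) : (Matrix n n ℂ)ˣ) : Matrix n n ℂ)‖ ≤ x₁)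
    (hbx : 23040 * (d : ℝ) ^ 4 * (frameC d L + d) ^ 2 * ((L : ℝ) ^ (j + 1)) ^ 2 * x ≤ 1)
    (hcx : 11520 * (d : ℝ) ^ 4 * (frameC d L + d) ^ 3 * ((L : ℝ) ^ (j + 1)) ^ 3 * x₁ ≤ 1)
    (hbx' : 256 * (d : ℝ) ^ 2 * ((L : ℝ) ^ (j + 1)) ^ 2 * x ≤ 1) (hcx' : 16 * (d : ℝ) * ((L : ℝ) ^ (j + 1)) ^ 3 * x₁ ≤ 1)
    {r₀ b₀ : ℝ} (hr₀ : ∀ (y : Site d) (μ : Fin d), ‖(((W y μ)⁻¹ * U y μ : (Matrix n n ℂ)ˣ) : (Matrix n n ℂ)) - 1‖ ≤ r₀)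
    (hb₀ : ∀ x : Site d, ‖covDiv W (fun y μ => mlog (((W y μ)⁻¹ * U y μ : (Matrix n n ℂ)ˣ) : (Matrix n n ℂ))) x‖ ≤ b₀)
    {cRE : ℝ} (hcRE : cRE = 1 + 2 * (Fintype.card n : ℝ) * (64 * (d : ℝ) ^ 2 * N) ^ d + 27 * (Fintype.card n : ℝ) ^ 3 * (512 : ℝ) ^ d * (N : ℝ) ^ d)
    (hreg₁ : (36 * (d : ℝ) * (frameC d L + d) ^ 2) * ((L : ℝ) ^ (j + 1)) ^ 2 * (cRE * b₀) ≤ 1 / 10)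
    (hreg₂ : (36 * (d : ℝ) * (frameC d L + d)) * (L : ℝ) ^ (j + 1) * (cRE * b₀) ≤ 1 / 25)
    (hreg₃ : r₀ + 5 / 2 * ((36 * (d : ℝ) * (frameC d L + d)) * (L : ℝ) ^ (j + 1) * (cRE * b₀)) ≤ 1 / 20)
    (hline : cRE * (4 * ((36 * (d : ℝ) * (frameC d L + d) ^ 2) * ((L : ℝ) ^ (j + 1)) ^ 2) * (b₀ + 4 * (cRE * b₀))
        + 25 * d * (r₀ + 5 / 2 * ((36 * (d : ℝ) * (frameC d L + d)) * (L : ℝ) ^ (j + 1) * (cRE * b₀))) * ((36 * (d : ℝ) * (frameC d L + d)) * (L : ℝ) ^ (j + 1))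
        + 14 * d * ((36 * (d : ℝ) * (frameC d L + d)) * (L : ℝ) ^ (j + 1)) ^ 2 * (cRE * b₀)) ≤ 1 / 2)
    -- E′'s radii named: `α_E` (sup radius of `Z`), `θ_u` (sup radius of `u − 1`); road (B)'s regime `α_E ≤ 1∕40`, `θ_u ≤ 1∕160`, and `α₀ ≥ α_E + 4θ_u + 4(6θ_u)(α_E + 4θ_u)`
    {αE θu : ℝ} (hαE : αE = 2 * (r₀ + 5 / 2 * ((36 * (d : ℝ) * (frameC d L + d)) * (L : ℝ) ^ (j + 1) * (cRE * b₀))))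
    (hθu : θu = 4 * ((36 * (d : ℝ) * (frameC d L + d) ^ 2) * ((L : ℝ) ^ (j + 1)) ^ 2 * (cRE * b₀)))
    (hαE40 : αE ≤ 1 / 40) (hθu160 : θu ≤ 1 / 160)
    (hα₀ : αE + 4 * θu + 4 * (2 * θu + 4 * θu) * (αE + 4 * θu) ≤ α₀)
    -- the remaining analytic letters at `W`: (L1)′ and α₁ for the SAME-TOP structured fields of radius `α₀`, (L2), (L3) discharged
    -- (L1)′ DISCHARGED (F111): the quadratic-remainder regime, the slice `S` containing the `W`-tangent skew periodic fields, and the names `c_N = 4m`, `ν = 24·#Plane·m`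
    (hs1 : LevelSmall d L (j + 1) x) (hA : curvSum d L (j + 1) x ≤ 2 / 3 * L) (hσ0 : 4 * (3 + 12 * (d : ℝ)) ^ 2 * (L : ℝ) ^ (j + 1) * α₀ ≤ rho0 d L ^ 2)
    (S : Set (Site d → Fin d → Matrix n n ℂ))
    (hS : ∀ X : Site d → Fin d → Matrix n n ℂ, IsSkewDir X → IsPeriodicDir X ((N * L ^ (j + 1) : ℕ) : ℤ) → dirIter L (j + 1) W X = 0 → X ∈ S)
    {cN KG ν : ℝ} (hcN : cN = 4 * (supC d L / ((L : ℝ) ^ (j + 1) * (1 - cruxC d L * (((L : ℝ) ^ (j + 1)) ^ 2 * x)))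
        * (4 * (3 + 12 * (d : ℝ)) ^ 3 / rho0 d L ^ 2 * ((L : ℝ) ^ (j + 1) * α₀) ^ 2)))
    (hνm : ν = 24 * (Fintype.card (T4AveragingDeficitWall.Plane d) : ℝ) * (supC d L / ((L : ℝ) ^ (j + 1) * (1 - cruxC d L * (((L : ℝ) ^ (j + 1)) ^ 2 * x)))
        * (4 * (3 + 12 * (d : ℝ)) ^ 3 / rho0 d L ^ 2 * ((L : ℝ) ^ (j + 1) * α₀) ^ 2)))
    -- α₁ FOR E′'s LANDAU REPRESENTATIVE ALONE
    {α₁Z : ℝ} (hα1Z : 0 ≤ α₁Z)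
    (hGradZ : ∀ Z : Site d → Fin d → Matrix n n ℂ, IsSkewDir Z → IsPeriodicDir Z ((N * L ^ (j + 1) : ℕ) : ℤ) → IsLandauB8 (d := d) L N (j + 1) W Z →
      (∀ y μ, ‖Z y μ‖ ≤ αE) → ∀ (y : Site d) (κ τ : Fin d), ‖Ad (W (y + e κ) τ) (Z (y + e τ) κ) - Z y κ‖ ≤ α₁Z)
    (hG : ∀ X ∈ S, IsPeriodicDir X ((N * L ^ (j + 1) : ℕ) : ℤ) → dirIter L (j + 1) W X = 0 → ∀ g : ℝ, 0 ≤ g →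
      (∀ Y : Site d → Fin d → Matrix n n ℂ, IsSkewDir Y → IsPeriodicDir Y ((N * L ^ (j + 1) : ℕ) : ℤ) → dirIter L (j + 1) W Y = 0 →
        |hess W X Y (perWin d (N * L ^ (j + 1)))| ≤ g * dirL1 Y (periodBox (d := d) (N * L ^ (j + 1)))) →
      ∀ z μ' ν', μ' ≠ ν' → ‖curlAt W X z μ' ν'‖ ≤ KG * g)
    (hcritW : ∀ Y : Site d → Fin d → Matrix n n ℂ, IsSkewDir Y → IsPeriodicDir Y ((N * L ^ (j + 1) : ℕ) : ℤ) → dirIter L (j + 1) W Y = 0 →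
      dAction W Y (perWin d (N * L ^ (j + 1))) = 0) :
    SmallField U (x + (KG * (
        ((x + 4 * (Real.exp α₀ - 1))
            * ((curl1C d L / (1 - thetaLoc d L * (((L : ℝ) ^ (j + 1)) ^ 2 * (x + 4 * (Real.exp α₀ - 1)))))
                * (((L : ℝ) ^ (j + 1)) ^ d / ((L : ℝ) ^ (j + 1)) ^ 2))
            * (Real.exp (((L : ℝ) ^ d / L) * ((d : ℝ) * (16 * ((d : ℝ) + 1) * ((d : ℝ) + 4) * (L : ℝ) ^ 2)
                  * (1250 * ((nbRad d L : ℝ) + L) + 8 * ((d : ℝ) * L) + 2 * L)) * (2 / twoLevelSmall d L))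
                * ((L : ℝ) / (L : ℝ) ^ d) ^ j
                * (((d : ℝ) * (2 * nbRad d L + 1) ^ d) * ((2 * (d : ℝ) + 4) * (L : ℝ) ^ 2) * (2 * (L : ℝ) ^ j) * (Real.exp α₀ - 1)
                  + (17 / 8 * ((L : ℝ) ^ 2) ^ j * (x + 4 * (Real.exp α₀ - 1)))
                    * (((d : ℝ) * (2 * nbRad d L + 1) ^ d) * ((2 * (d : ℝ) + 4)
                          * (2 * (2 * L * (nbRad d L : ℝ) + 128 * ((d : ℝ) + 1) * ((d : ℝ) + 4) * (L : ℝ) ^ 2)))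
                      + ((d : ℝ) * (2 * nbRad d L + 1) ^ d) * ((2 * (d : ℝ) + 4) * (L : ℝ) ^ 2 * (2 * (nbRad d L : ℝ))
                          + 2 * (8 * (L : ℝ) + (1250 * ((nbRad d L : ℝ) + L) + 8 * (d * L) + 2 * L))
                              * (16 * ((d : ℝ) + 1) * ((d : ℝ) + 4) * (L : ℝ) ^ 2))))))
        + (Fintype.card (T4AveragingDeficitWall.Plane d) : ℝ)
          * (2 * (240 * (Real.exp α₀ - 1) * α₀ * (2 * (α₁Z + 2 * (4 * θu) + 2 * (4 * (2 * θu + 4 * θu) * (αE + 4 * θu))) + 24 * α₀ * (Real.exp α₀ - 1) + x) + 8 * α₀ * (2 * (α₁Z + 2 * (4 * θu) + 2 * (4 * (2 * θu + 4 * θu) * (αE + 4 * θu))) + 24 * α₀ * (Real.exp α₀ - 1))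
              + 6 * (Real.exp α₀ - 1) * (2 * (α₁Z + 2 * (4 * θu) + 2 * (4 * (2 * θu + 4 * θu) * (αE + 4 * θu))) + 24 * (Real.exp α₀ - 1) * α₀)
              + (2 * (α₁Z + 2 * (4 * θu) + 2 * (4 * (2 * θu + 4 * θu) * (αE + 4 * θu))) + 24 * (Real.exp α₀ - 1) * α₀) * (2 * (α₁Z + 2 * (4 * θu) + 2 * (4 * (2 * θu + 4 * θu) * (αE + 4 * θu))) + 24 * α₀ * (Real.exp α₀ - 1))
              + 960 * (Real.exp α₀ - 1) * α₀ ^ 2 + 32 * x * α₀ ^ 2)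
            + (64 * α₀ * (α₁Z + 2 * (4 * θu) + 2 * (4 * (2 * θu + 4 * θu) * (αE + 4 * θu))) + 1024 * x * α₀ ^ 2))
        + ν) + cN + 28 * α₀ ^ 2)) := by
  have hb0 : 0 ≤ b₀ := (norm_nonneg _).trans (hb₀ 0)
  have hr0 : 0 ≤ r₀ := (norm_nonneg _).trans (hr₀ 0 ⟨0, by omega⟩)
  have hfr : 0 ≤ frameC d L := by unfold frameC; positivity
  have hθu0 : 0 ≤ θu := by rw [hθu, hcRE]; positivity
  have hαE0 : 0 ≤ αE := by rw [hαE, hcRE]; positivity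
  have hα1 : 0 ≤ α₁Z + 2 * (4 * θu) + 2 * (4 * (2 * θu + 4 * θu) * (αE + 4 * θu)) := by positivity
  refine smallField_of_tanCritical_roadB_lifted hd hL j hWu hWP hx hs hWx hα0 hs' hθ hθl hε hUu hUP hxU hsU hUxU hcritU hTopUW hx10 hgrad hbx hcx hbx' hcx'
    hr₀ hb₀ hcRE hreg₁ hreg₂ hreg₃ hline hαE hθu hαE40 hθu160 hα₀ hs1 hA hσ0 S hS hcN hνm hα1 ?_ hG hcritW
  intro Z σ Z' hZs hZP hLan hZα _ _ _ hσδ _ _ _ _ hstr y κ τ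
  have h := norm_grad_structured_le (hWu (y + e κ) τ) (Z (y + e τ) κ) (Z y κ) (gaugeDir W σ (y + e τ) κ) (gaugeDir W σ y κ) (Z' (y + e τ) κ) (Z' y κ)
  linarith [hGradZ Z hZs hZP hLan hZα y κ τ, hσδ (y + e τ) κ, hσδ y κ, hstr (y + e τ) κ, hstr y κ]

end

end Summit.QuantumFields.BalabanUV.T4Continuum.NE7ApeCurvedRepRoadBFinal
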